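import Summits.BirchSwinnertonDyer.BirchSwinnertonDyer.Theorems.RamifiedHeegnerPairLeafRankOneUpperAtThreeMonoCarrier
import Summits.BirchSwinnertonDyer.BirchSwinnertonDyer.Theorems.ByReductionTypeAtTwoOrdEisensteinHalfShaIsogeny
import Summits.BirchSwinnertonDyer.Rank1Residual.X2.IsogenyClassStability
import Summits.BirchSwinnertonDyer.Rank1Residual.Additive.GordIsogenyInvarianceClasses
import Summits.BirchSwinnertonDyer.Rank1Residual.X12.CMIsogenyInvariance
import Literature.NumberTheory.Automorphic.ShimuraCurveRibetTakahashiOptimalModularityProofs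
import Literature.NumberTheory.EllipticCurves.ManinConstantQuadraticTwistIstarProofs
import Literature.NumberTheory.EllipticCurves.ModularCurveNonempty
import Literature.NumberTheory.EllipticCurves.ComplexMultiplicationLFunctionIsogenyHoldsProofs
import HarnessLib

/-!
# Route `RamifiedHeegnerPair`, crux U₁ `LeafRankOneUpperAtThree` (stmt-BirchSwinnertonDyer-26022), line `splitkolyvagin` —
# the MANIN CLAUSE of the row predicate is DISCHARGED on the leaf (modulo print): U₁ is an isogeny-CLASS statement,
# the optimal member of the class carries a lattice-optimal datum, and Gss2 ⇒ Kodaira `I₀*` at `3` ⇒ `3 ∤ c`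

HONEST FRAMING. Theorems only; helper file (`--supports stmt-BirchSwinnertonDyer-26022 --as helper`); nothing is booked,
no item is closed, BSD is not proved for any curve; CONDITIONAL on every displayed input. Lead prover bsd-line-rhp-p2 g5,
2026-08-28.

The registered skeleton v3 (`Cruxes/LeafRankOneUpperAtThree/Lines/splitkolyvagin.lean`, d9e23cc3; composition p615347 §4)
cuts U₁ into PUB + S2 + Σ′ + L₀, where the mono-multiplicative-carrier rows served by the reading S2 carry a DISPLAYED
Manin clause «`∃` a parametrisation datum of `W` at level `N_W` with `3 ∤ c`» (g4's census note: "Manin clause displayed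
everywhere — Edixhoven needs `p > 7`; Cremona `c = 1` in range is evidence only"), and the research residue Σ′ is asked
on every row failing it. THIS FILE removes that clause from the line, in the kernel, modulo PRINT:

* §1 — the LEAF is an isogeny-class property: `¬ HasCM`, `Addv · 3`, `SubGss · 3` and the analytic rank transfer along
  every `ℚ`-isogeny of globally minimal curves (tree: `X12.hasCM_iff_of_isIsogenous`, `X2.addv_iff_of_isIsogenous`,
  `Additive.subGord_iff_of_isIsogenous` / `typeGOrd_iff_of_isIsogenous`, `analyticRank_eq_of_isIsogenous'` — all proved).
* §2 — the HALF `Typed.MissingUpperBoundAt W 3` is an isogeny-CLASS statement at analytic rank `≤ 1`: Cassels'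
  invariance of the BSD quotient (named fact `WeierstrassCurve.bsdRHS_eq_of_isIsogenous`, Cassels 1965 / Milne ADT
  I.7.3) + GZK (finiteness of `Ш`) + `L* ≠ 0` (`leadingLCoeff_ne_zero_holds`), via the tree's
  `EisensteinShaCurrency.missingUpperBoundAt_of_isIsogenous`.
* §3 — MANIN ON THE LEAF: for a LATTICE-OPTIMAL datum `D` (`Λ_E = c · Λ_f`) of a leaf curve, `3 ∤ c(D)`: Gss2 ⇒ Kodaira
  `I₀*` at `3` (p615347 §1 `kodairaSymbolAt_three_eq_Istar_zero_of_subGss`) and the tree's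
  `not_dvd_maninConstant_of_kodairaSymbolAt_eq_Istar_zero` (Stevens 1989 (5.2)/(5.4) PROVED in the tree: the twist
  `E ⊗ χ₋₃` is good at `3`), modulo the three printed prime-by-prime Manin facts `hM` (Mazur 1978 Cor. 4.1), `hAU`
  (Abbes–Ullmo 1996 Thm. A), `hC2` (Česnavičius 2018 Thm. 1.2) and modularity `hnf`. The OPTIMAL member (a globally
  minimal model of the strong Weil curve, with a lattice-optimal datum of minimal degree) exists in every isogeny class
  by MODULARITY ALONE (`exists_optimal_modularParametrizationData_of_modularity`, Edixhoven's `c ∈ ℤ` being the tree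
  theorem `edixhoven_int_of_neronLattice_eq_smul_periodLattice_holds`).
* §4 — U₁ at a leaf curve CARRYING a lattice-optimal datum ⟸ print + S2 + Σ″ + L₀, where Σ″ is Σ′ with the Manin
  conjunct DROPPED from the row predicate and the extra binder «the datum is lattice-optimal» (so Σ″ is asked at optimal
  members only, off the mono-multiplicative-carrier rows; Σ′ ⟹ Σ″, §4).
* §5 (sibling file `…LeafRankOneUpperAtThreeOptimalMember.lean`) — THE RESHAPED COMPOSITION (skeleton v4):
  `LeafRankOneUpperAtThree` ⟸ PUB⁺ + S2 + Σ″ + L₀ with PUB⁺ = PUB ∧ Cassels ∧ hM ∧ hAU ∧ hC2 (print): move to the optimal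
  member `W₀ ∼ W` (§1, §3), settle U₁ there (§4), transport back (§2).

What this is NOT: not a proof of S2 nor of Σ″; the Tamagawa row predicate is now READ AT THE OPTIMAL MEMBER (the
`3`-parts of the Tamagawa numbers are class invariants on the leaf since `E[3]` is irreducible, but that is not used or
proved here); U₁ stays OPEN; BSD is not proved.

References: [cite: Mazur1978, Cor. 4.1] [cite: AbbesUllmo1996, Thm. A] [cite: Cesnavicius2018, Thm. 1.2]
[cite: EdixhovenManin1991, §1 and Prop. 2] [cite: Stevens1989, Lemmas (5.2), (5.4)] [cite: Cassels1965ArithmeticVIII]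
[cite: MilneADT2006, Thm. I.7.3 and Remark I.7.4] [cite: Miller2011LMS, §1 and Def. 1.1] [cite: Jetchev2008, Thm. 1.4, Cor. 1.5
(p. 812)] [cite: MatarNekovar2019, Thm. 0.7 (p. 456)] [cite: PastenShimura2024, §2 p. 12 and §10.1 p. 33]
[cite: SilvermanATAEC1994, IV.9.4 Step 6 (PDF p. 345)].
-/

-- D-0017: single-problem summit, so `Summit.BirchSwinnertonDyer.BirchSwinnertonDyer.…` repeats a namespace BY DESIGN.
set_option linter.dupNamespace false
set_option autoImplicit false

noncomputable section

open scoped Classical NumberField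

open WeierstrassCurve IsDedekindDomain IsDedekindDomain.HeightOneSpectrum NumberField
  Rat.HeightOneSpectrum Literature Literature.NumberTheory.EllipticCurves
  Literature.NumberTheory.EllipticCurves.ModularForms
  Literature.NumberTheory.EllipticCurves.Rank1Residual
  Literature.NumberTheory.EllipticCurves.Rank1Residual.Typed
  Literature.NumberTheory.QuadraticFields
  Summit.BirchSwinnertonDyer.Rank1Residual
  Summit.BirchSwinnertonDyer.Rank1Residual.Additive
  Summit.BirchSwinnertonDyer.Rank1Residual.X11b.Three
  Summit.BirchSwinnertonDyer.BirchSwinnertonDyer.Theses.RamifiedHeegnerPair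
  Summit.BirchSwinnertonDyer.BirchSwinnertonDyer.Theorems

namespace Summit.BirchSwinnertonDyer.BirchSwinnertonDyer.Theorems.RamifiedPairUpperBound

/-! ## §1 The leaf is an isogeny-class property -/

section LeafIsogeny

variable {W W' : WeierstrassCurve ℚ} [W.IsElliptic] [W.IsGloballyMinimal] [W'.IsElliptic] [W'.IsGloballyMinimal]

/-- **The census cell `(G) ∧ ss` = `SubGss` is a `ℚ`-isogeny-class property** (odd `p`, `E` additive at `p`, globally
minimal models): both conjuncts `SubGord` and `¬ TypeGOrd` are (`subGord_iff_of_isIsogenous`, `typeGOrd_iff_of_isIsogenous`).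
[cite: SilvermanAEC2009, Cor. VII.7.2] -/
theorem subGss_iff_of_isIsogenous {p : ℕ} [Fact p.Prime] (hp2 : p ≠ 2) (hadd : Addv W p) (h : IsIsogenous W W') :
    SubGss W p ↔ SubGss W' p := by
  unfold SubGss
  rw [subGord_iff_of_isIsogenous hp2 hadd h, typeGOrd_iff_of_isIsogenous hp2 hadd h]

/-- **The leaf Gss2 at `3` transfers along `ℚ`-isogenies**: for globally minimal `W ∼ W'`, if `W` is non-CM, additive
of cell `(G) ∧ ss` at `3`, then so is `W'`, with the same analytic rank (`hasCM_iff_of_isIsogenous`,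
`X2.addv_iff_of_isIsogenous`, `subGss_iff_of_isIsogenous`, `analyticRank_eq_of_isIsogenous'` — all unconditional).
[cite: SilvermanAEC2009, Cor. VII.7.2] [cite: Knapp1993, Thm. 11.67 (PDF p. 281)] -/
theorem leaf_of_isIsogenous (h : IsIsogenous W W') (hCM : ¬ W.HasCM) (hadd : Addv W 3) (hsub : SubGss W 3) :
    ¬ W'.HasCM ∧ Addv W' 3 ∧ SubGss W' 3 ∧ W'.analyticRank = W.analyticRank := by
  haveI : Fact (Nat.Prime 3) := ⟨Nat.prime_three⟩
  refine ⟨fun hCM' ↦ hCM ((X12.hasCM_iff_of_isIsogenous h).mpr hCM'), (X2.addv_iff_of_isIsogenous h).mp hadd,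
    (subGss_iff_of_isIsogenous (by decide) hadd h).mp hsub, (analyticRank_eq_of_isIsogenous' h).symm⟩

end LeafIsogeny

/-! ## §2 The upper half is an isogeny-class statement at analytic rank `≤ 1` -/

section ClassHalf

variable {W W' : WeierstrassCurve ℚ} [W.IsElliptic] [W.IsGloballyMinimal] [W'.IsElliptic] [W'.IsGloballyMinimal]

/-- **`Typed.MissingUpperBoundAt · p` transports along `ℚ`-isogenies at analytic rank `≤ 1`.** For globally minimal
`W ∼ W'` with `r_an(W) ≤ 1`: `MissingUpperBoundAt W' p → MissingUpperBoundAt W p`, modulo Cassels' isogeny invariance of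
the BSD quotient (`hCassels`), GZK (`hGZK`: `Ш(W')` finite since `r_an(W') = r_an(W) ≤ 1`) and modularity Version L
(`hmod`: `L` entire, so `L*(W',1) ≠ 0` by `leadingLCoeff_ne_zero_holds`) — the tree's
`EisensteinShaCurrency.missingUpperBoundAt_of_isIsogenous`. [cite: MilneADT2006, Thm. I.7.3 and Remark I.7.4]
[cite: Miller2011LMS, §1 (arXiv:1010.2431 p. 3)] -/
theorem missingUpperBoundAt_of_isIsogenous_of_analyticRank_le_one (hCassels : bsdRHS_eq_of_isIsogenous)
    (hGZK : rank_eq_analyticRank_of_analyticRank_le_one) (hmod : hasEntireLFunction_rat) {p : ℕ} [Fact p.Prime]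
    (hr : W.analyticRank ≤ 1) (hiso : IsIsogenous W W') (h : MissingUpperBoundAt W' p) :
    MissingUpperBoundAt W p := by
  have hr' : W'.analyticRank ≤ 1 := by rw [← analyticRank_eq_of_isIsogenous' hiso]; exact hr
  have hfin' : Finite W'.sha := (hGZK W' hr').2
  have hlead : W'.leadingLCoeff ≠ 0 := W'.leadingLCoeff_ne_zero_holds (hmod W')
  exact EisensteinShaCurrency.missingUpperBoundAt_of_isIsogenous hCassels hiso hfin' hlead h

/-- The lower half likewise (recorded for the L-side leads; same inputs). [cite: MilneADT2006, Thm. I.7.3 and Remark I.7.4]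
[cite: Miller2011LMS, §1 (arXiv:1010.2431 p. 3)] -/
theorem missingLowerBoundAt_of_isIsogenous_of_analyticRank_le_one (hCassels : bsdRHS_eq_of_isIsogenous)
    (hGZK : rank_eq_analyticRank_of_analyticRank_le_one) (hmod : hasEntireLFunction_rat) {p : ℕ} [Fact p.Prime]
    (hr : W.analyticRank ≤ 1) (hiso : IsIsogenous W W') (h : MissingLowerBoundAt W' p) :
    MissingLowerBoundAt W p := by
  have hr' : W'.analyticRank ≤ 1 := by rw [← analyticRank_eq_of_isIsogenous' hiso]; exact hr
  have hfin' : Finite W'.sha := (hGZK W' hr').2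
  have hlead : W'.leadingLCoeff ≠ 0 := W'.leadingLCoeff_ne_zero_holds (hmod W')
  exact EisensteinShaCurrency.missingLowerBoundAt_of_isIsogenous hCassels hiso hfin' hlead h

end ClassHalf

/-! ## §3 Manin on the leaf: a lattice-optimal datum of a leaf curve has `3 ∤ c`; the optimal member exists -/

section Manin

/-- **`3 ∤ c(D)` for a LATTICE-OPTIMAL datum of a leaf curve** (modulo the printed Manin facts `hM`, `hAU`, `hC2` and
modularity `hnf`). For `W/ℚ` globally minimal, additive of cell `(G) ∧ ss` at `3`, and a parametrisation datum `D` at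
any level `N` with `Λ_E = c · Λ_f` (`hopt`): the fibre at `3` is Kodaira `I₀*` (`kodairaSymbolAt_three_eq_Istar_zero_of_subGss`),
so the tree theorem `not_dvd_maninConstant_of_kodairaSymbolAt_eq_Istar_zero` (the twist `E ⊗ χ₋₃` is GOOD at `3`,
Stevens 1989 (5.2)/(5.4), proved in the tree; then Mazur/Abbes–Ullmo/Česnavičius by name) gives `3 ∤ c`. No `p > 7`.
[cite: EdixhovenManin1991, §1 (typescript L96–101)] [cite: Stevens1989, Lemmas (5.2), (5.4)] [cite: Mazur1978, Cor. 4.1]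
[cite: AbbesUllmo1996, Thm. A] [cite: Cesnavicius2018, Thm. 1.2] [cite: SilvermanATAEC1994, IV.9.4 Step 6 (PDF p. 345)] -/
theorem not_three_dvd_c_of_latticeOptimal_of_subGss
    (hM : mazur_not_dvd_maninConstant_of_odd) (hAU : abbesUllmo_not_dvd_maninConstant_of_not_dvd_level)
    (hC2 : cesnavicius_not_two_dvd_maninConstant_of_two_dvd_level) (hnf : exists_isNewformOf)
    (W : WeierstrassCurve ℚ) [W.IsElliptic] [W.IsGloballyMinimal] {N : ℕ} [NeZero N]
    (D : ModularParametrizationData W N) (hopt : ∀ z ∈ D.L.lattice, ∃ w ∈ periodLattice D.f, z = D.c * w)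
    (hadd : Addv W 3) (hsub : SubGss W 3) : ¬ (3 : ℤ) ∣ D.c := by
  haveI : Fact (Nat.Prime 3) := ⟨Nat.prime_three⟩
  have hK : W.kodairaSymbolAt ((primesEquiv (R := ℤ)).symm ⟨3, Nat.prime_three⟩) = .Istar 0 :=
    kodairaSymbolAt_three_eq_Istar_zero_of_subGss W hadd hsub
  exact_mod_cast not_dvd_maninConstant_of_kodairaSymbolAt_eq_Istar_zero hM hAU hC2 hnf D hopt Nat.prime_three
    (by decide) hK

/-- **The optimal member of a leaf class.** For a non-CM leaf curve `W` (globally minimal, `Addv W 3`, `SubGss W 3`),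
modularity alone (`hnf`, through `exists_optimal_modularParametrizationData_of_modularity`: Eichler–Shimura + Faltings +
Edixhoven's `c ∈ ℤ`, the last a tree theorem) gives a globally minimal `W₀ ∼ W` carrying a LATTICE-OPTIMAL datum `D₀`
at level `N_{W₀} = N_W` (the `ℚ`-model of the strong Weil curve `ℂ/Λ_f`; minimal degree forces `Λ_{E₀} = c₀ Λ_f`,
`latticeEq_of_forall_modularDegree_le`; the level is the conductor by `level_eq_conductorNorm_of_exists`), and `W₀` is
again a non-CM leaf curve of the same analytic rank (§1). [cite: PastenShimura2024, §2 p. 12 and §10.1 p. 33]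
[cite: Knapp1993, Prop. 12.9(a) and p. 302] [cite: DiamondShurman2005, Thm. 8.8.1] -/
theorem exists_optimal_leaf_member (hnf : exists_isNewformOf)
    (W : WeierstrassCurve ℚ) [W.IsElliptic] [W.IsGloballyMinimal] (hCM : ¬ W.HasCM) (hadd : Addv W 3)
    (hsub : SubGss W 3) :
    ∃ (W₀ : WeierstrassCurve ℚ) (_ : W₀.IsElliptic) (_ : W₀.IsGloballyMinimal) (N : ℕ) (_ : NeZero N)
      (D₀ : ModularParametrizationData W₀ N),
      IsIsogenous W W₀ ∧ W₀.conductorNorm ℤ = N ∧ W.conductorNorm ℤ = N ∧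
      (∀ z ∈ D₀.L.lattice, ∃ w ∈ periodLattice D₀.f, z = D₀.c * w) ∧
      ¬ W₀.HasCM ∧ Addv W₀ 3 ∧ SubGss W₀ 3 ∧ W₀.analyticRank = W.analyticRank := by
  haveI : NeZero (W.conductorNorm ℤ) := ⟨(W.conductorNorm_pos_holds).ne'⟩
  obtain ⟨W₀, hW₀, hW₀', D₀, -, hiso, hmin⟩ :=
    Literature.NumberTheory.Automorphic.exists_optimal_modularParametrizationData_of_modularity hnf
      (W.conductorNorm ℤ) W rfl
  haveI := hW₀
  haveI := hW₀'
  have hN₀ : W.conductorNorm ℤ = W₀.conductorNorm ℤ :=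
    ModularParametrizationData.level_eq_conductorNorm_of_exists hnf D₀
  have hopt : ∀ z ∈ D₀.L.lattice, ∃ w ∈ periodLattice D₀.f, z = D₀.c * w :=
    D₀.latticeEq_of_forall_modularDegree_le hmin
  exact ⟨W₀, hW₀, hW₀', W.conductorNorm ℤ, inferInstance, D₀, hiso, hN₀.symm, rfl, hopt,
    leaf_of_isIsogenous hiso hCM hadd hsub⟩

end Manin


/-! ## §4 U₁ at a leaf curve carrying a lattice-optimal datum ⟸ print + S2 + Σ″ + L₀ (no Manin clause) -/

section OptimalMember

/-- **Σ″ ⟸ Σ′** (weakening: the new research residue is IMPLIED by the registered one). Σ″ =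
`stub_leafSigmaDivisibilityAtThreeOptimalOffRows` is Σ′ = `stub_leafSigmaDivisibilityAtThreeOffRows` with the Manin conjunct
«`∃` a datum with `3 ∤ c`» DROPPED from the (negated) row predicate and the binder «`Dt` is lattice-optimal» added; since the
mono-multiplicative-carrier Manin-clean row predicate implies the Manin-free one, every instance of Σ″ is an instance of Σ′.
[cite: Jetchev2008, Conj. 1.3 (p. 812)] -/
theorem sigmaOptOffRows_of_sigmaOffRows
    (hSig' : ∀ (W : WeierstrassCurve ℚ) [W.IsElliptic] [W.IsGloballyMinimal] (N : ℕ) [NeZero N]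
      (K : Type) [Field K] [NumberField K]
      (Dt : Literature.NumberTheory.EllipticCurves.ModularForms.ModularParametrizationData W N)
      (H : Literature.NumberTheory.EllipticCurves.HeegnerDatum N (NumberField.discr K)) (ι : K →+* ℂ)
      (P : (W.baseChange K).toAffine.Point),
      ¬ W.HasCM → Literature.NumberTheory.EllipticCurves.Rank1Residual.Addv W 3 →
      Summit.BirchSwinnertonDyer.Rank1Residual.Additive.SubGss W 3 → W.analyticRank = 1 →
      W.conductorNorm ℤ = N →
      ¬ ((∃ (q : ℕ) (_ : Fact q.Prime), q ∣ N ∧ ¬ q ^ 2 ∣ N ∧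
          padicValNat 3 W.tamagawaProduct ≤ padicValNat 3 ((W.baseChange ℚ_[q]).localTamagawaNumber ℤ_[q])) ∧
        (∀ (q' : ℕ) [Fact q'.Prime], q' ∣ N →
          3 ∣ (W.baseChange ℚ_[q']).localTamagawaNumber ℤ_[q'] → ¬ q' ^ 2 ∣ N) ∧
        (∃ Dt' : Literature.NumberTheory.EllipticCurves.ModularForms.ModularParametrizationData W N, ¬ (3 : ℤ) ∣ Dt'.c)) →
      Literature.NumberTheory.EllipticCurves.IsImaginaryQuadratic K →
      Literature.NumberTheory.EllipticCurves.SatisfiesHeegnerHypothesis N K →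
      (W.quadraticTwist (NumberField.discr K : ℚ)).entireLFunction 1 ≠ 0 →
      (WeierstrassCurve.Affine.Point.map ι.toRatAlgHom) P =
        Literature.NumberTheory.EllipticCurves.ModularForms.heegnerPointComplex Dt H →
      ¬ IsOfFinAddOrder P → Odd (NumberField.discr K) →
      ∀ (s' : ℕ), s' ≤ padicValNat 3 W.tamagawaProduct + padicValNat 3 Dt.c.natAbs →
      ∀ (n : ℕ) (d : Literature.NumberTheory.EllipticCurves.KolyvaginHeegnerData Dt H.β ι n), Squarefree n →
      (∀ ℓ ∈ n.primeFactors, Literature.NumberTheory.EllipticCurves.Zhang2014.IsKolyvaginPrime N W K 3 ℓ ∧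
        s' ≤ Literature.NumberTheory.EllipticCurves.Zhang2014.kolyvaginIndex W 3 ℓ) →
      Summit.BirchSwinnertonDyer.Rank1Residual.X11b.Three.Koly.PDiv d 3 s') :
    ∀ (W : WeierstrassCurve ℚ) [W.IsElliptic] [W.IsGloballyMinimal] (N : ℕ) [NeZero N]
      (K : Type) [Field K] [NumberField K]
      (Dt : Literature.NumberTheory.EllipticCurves.ModularForms.ModularParametrizationData W N)
      (H : Literature.NumberTheory.EllipticCurves.HeegnerDatum N (NumberField.discr K)) (ι : K →+* ℂ)
      (P : (W.baseChange K).toAffine.Point),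
      ¬ W.HasCM → Literature.NumberTheory.EllipticCurves.Rank1Residual.Addv W 3 →
      Summit.BirchSwinnertonDyer.Rank1Residual.Additive.SubGss W 3 → W.analyticRank = 1 →
      W.conductorNorm ℤ = N →
      (∀ z ∈ Dt.L.lattice, ∃ w ∈ Literature.NumberTheory.EllipticCurves.ModularForms.periodLattice Dt.f, z = Dt.c * w) →
      ¬ ((∃ (q : ℕ) (_ : Fact q.Prime), q ∣ N ∧ ¬ q ^ 2 ∣ N ∧
          padicValNat 3 W.tamagawaProduct ≤ padicValNat 3 ((W.baseChange ℚ_[q]).localTamagawaNumber ℤ_[q])) ∧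
        (∀ (q' : ℕ) [Fact q'.Prime], q' ∣ N →
          3 ∣ (W.baseChange ℚ_[q']).localTamagawaNumber ℤ_[q'] → ¬ q' ^ 2 ∣ N)) →
      Literature.NumberTheory.EllipticCurves.IsImaginaryQuadratic K →
      Literature.NumberTheory.EllipticCurves.SatisfiesHeegnerHypothesis N K →
      (W.quadraticTwist (NumberField.discr K : ℚ)).entireLFunction 1 ≠ 0 →
      (WeierstrassCurve.Affine.Point.map ι.toRatAlgHom) P =
        Literature.NumberTheory.EllipticCurves.ModularForms.heegnerPointComplex Dt H →
      ¬ IsOfFinAddOrder P → Odd (NumberField.discr K) →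
      ∀ (s' : ℕ), s' ≤ padicValNat 3 W.tamagawaProduct + padicValNat 3 Dt.c.natAbs →
      ∀ (n : ℕ) (d : Literature.NumberTheory.EllipticCurves.KolyvaginHeegnerData Dt H.β ι n), Squarefree n →
      (∀ ℓ ∈ n.primeFactors, Literature.NumberTheory.EllipticCurves.Zhang2014.IsKolyvaginPrime N W K 3 ℓ ∧
        s' ≤ Literature.NumberTheory.EllipticCurves.Zhang2014.kolyvaginIndex W 3 ℓ) →
      Summit.BirchSwinnertonDyer.Rank1Residual.X11b.Three.Koly.PDiv d 3 s' := by
  intro W _ _ N _ K _ _ Dt H ι P hCM hadd hsub hr hN _hopt hrow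
  exact hSig' W N K Dt H ι P hCM hadd hsub hr hN (fun h ↦ hrow ⟨h.1, h.2.1⟩)

/-- **U₁ AT A LEAF CURVE CARRYING A LATTICE-OPTIMAL DATUM, from print + S2 + Σ″ + L₀ — NO Manin clause.** For `W/ℚ`
globally minimal, non-CM, leaf Gss2 at `3`, `r_an(W) = 1`, and a parametrisation datum `Dt` at level `N_W` with
`Λ_E = c · Λ_f` (`hopt`; i.e. `W` is a minimal model of the optimal curve of its class): `Typed.MissingUpperBoundAt W 3`.
Case split on the Manin-FREE row predicate (mono-multiplicative `3`-carrier `q ∥ N_W` + the reading's global Tamagawa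
binder): ON the row, p615347 §2 with the datum `Dt` itself, whose `3 ∤ c` is §3
(`not_three_dvd_c_of_latticeOptimal_of_subGss`, modulo `hM hAU hC2 hnf`); OFF the row, p610955's
`leafRankOneUpper_three_of_sigmaAtDatum_of_lowerRankZero` with Σ″ at `Dt`. CONDITIONAL on every displayed input; nothing
asserted about any curve. [cite: Jetchev2008, Thm. 1.4 and Cor. 1.5 (p. 812)] [cite: MatarNekovar2019, Thm. 0.7 (p. 456)]
[cite: Mazur1978, Cor. 4.1] [cite: Stevens1989, Lemmas (5.2), (5.4)] [cite: FriedbergHoffstein1995, Thm. B]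
[cite: GrossZagier1986, Thm. I.(6.3) and (7.3)] [cite: Miller2011LMS, Def. 1.1] -/
theorem leafRankOneUpper_three_of_latticeOptimal_of_divisibilityReading_of_sigmaOptOffRows_of_lowerRankZero
    (hGZ : ∀ (N : ℕ) [NeZero N] (W : WeierstrassCurve ℚ) (K : Type) [Field K] [NumberField K],
      gross_zagier N W K)
    (hKo : ∀ (N : ℕ) [NeZero N] (W : WeierstrassCurve ℚ) (K : Type) [Field K] [NumberField K],
      kolyvagin N W K)
    (hGZK : rank_eq_analyticRank_of_analyticRank_le_one) (hmod : hasEntireLFunction_rat)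
    (hGZ73 : GrossZagier1986_thm_I_7_3)
    (hMN : MatarNekovar2019.thm07_padicValNat_card_sha_primary_add_le_of_globalDivisibility_of_irreducible)
    (hnf : exists_isNewformOf) (hFH : friedbergHoffstein_exists_heegnerField_splitDivisors_twist_ne_zero)
    (hM : mazur_not_dvd_maninConstant_of_odd) (hAU : abbesUllmo_not_dvd_maninConstant_of_not_dvd_level)
    (hC2 : cesnavicius_not_two_dvd_maninConstant_of_two_dvd_level)
    (hD : ∀ (W : WeierstrassCurve ℚ) [W.IsElliptic] [W.IsGloballyMinimal] [NeZero (W.conductorNorm ℤ)],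
      ¬ W.HasCM →
      ∀ (K : Type) [Field K] [NumberField K], Literature.NumberTheory.EllipticCurves.IsImaginaryQuadratic K →
      NumberField.discr K ≠ -3 → NumberField.discr K ≠ -4 →
      Literature.NumberTheory.EllipticCurves.SatisfiesHeegnerHypothesis (W.conductorNorm ℤ) K →
      ∀ (p : ℕ) [Fact p.Prime], p ≠ 2 → Literature.NumberTheory.EllipticCurves.Rank1Residual.Addv W p →
      0 ≤ padicValRat p W.j → W.HasIrreducibleModPGaloisRep p →
      ¬ p ∣ (W.baseChange ℚ_[p]).localTamagawaNumber ℤ_[p] →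
      (∀ (q' : ℕ) [Fact q'.Prime], q' ∣ W.conductorNorm ℤ →
        p ∣ (W.baseChange ℚ_[q']).localTamagawaNumber ℤ_[q'] → ¬ q' ^ 2 ∣ W.conductorNorm ℤ) →
      ∀ (Dt : Literature.NumberTheory.EllipticCurves.ModularForms.ModularParametrizationData W (W.conductorNorm ℤ))
        (β : ℤ) (ι : K →+* ℂ) (d₁ : Literature.NumberTheory.EllipticCurves.KolyvaginHeegnerData Dt β ι 1),
        ¬ IsOfFinAddOrder d₁.derivedPoint →
      ∀ (q : ℕ) [Fact q.Prime], q ∣ W.conductorNorm ℤ → ¬ q ^ 2 ∣ W.conductorNorm ℤ → q ≠ p →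
      ∀ (s : ℕ), s ≤ padicValNat p ((W.baseChange ℚ_[q]).localTamagawaNumber ℤ_[q]) →
      ∀ (n : ℕ) (d : Literature.NumberTheory.EllipticCurves.KolyvaginHeegnerData Dt β ι n), Squarefree n →
        (∀ ℓ ∈ n.primeFactors, Literature.NumberTheory.EllipticCurves.Zhang2014.IsKolyvaginPrime (W.conductorNorm ℤ) W K p ℓ ∧
          s ≤ Literature.NumberTheory.EllipticCurves.Zhang2014.kolyvaginIndex W p ℓ) →
        ∃ Q : (W.baseChange (Literature.NumberTheory.EllipticCurves.ringClassField K ι n)).toAffine.Point,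
          ((p ^ s : ℕ) : ℤ) • Q = d.derivedPoint)
    (hSig : ∀ (W : WeierstrassCurve ℚ) [W.IsElliptic] [W.IsGloballyMinimal] (N : ℕ) [NeZero N]
      (K : Type) [Field K] [NumberField K]
      (Dt : Literature.NumberTheory.EllipticCurves.ModularForms.ModularParametrizationData W N)
      (H : Literature.NumberTheory.EllipticCurves.HeegnerDatum N (NumberField.discr K)) (ι : K →+* ℂ)
      (P : (W.baseChange K).toAffine.Point),
      ¬ W.HasCM → Literature.NumberTheory.EllipticCurves.Rank1Residual.Addv W 3 →
      Summit.BirchSwinnertonDyer.Rank1Residual.Additive.SubGss W 3 → W.analyticRank = 1 →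
      W.conductorNorm ℤ = N →
      (∀ z ∈ Dt.L.lattice, ∃ w ∈ Literature.NumberTheory.EllipticCurves.ModularForms.periodLattice Dt.f, z = Dt.c * w) →
      ¬ ((∃ (q : ℕ) (_ : Fact q.Prime), q ∣ N ∧ ¬ q ^ 2 ∣ N ∧
          padicValNat 3 W.tamagawaProduct ≤ padicValNat 3 ((W.baseChange ℚ_[q]).localTamagawaNumber ℤ_[q])) ∧
        (∀ (q' : ℕ) [Fact q'.Prime], q' ∣ N →
          3 ∣ (W.baseChange ℚ_[q']).localTamagawaNumber ℤ_[q'] → ¬ q' ^ 2 ∣ N)) →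
      Literature.NumberTheory.EllipticCurves.IsImaginaryQuadratic K →
      Literature.NumberTheory.EllipticCurves.SatisfiesHeegnerHypothesis N K →
      (W.quadraticTwist (NumberField.discr K : ℚ)).entireLFunction 1 ≠ 0 →
      (WeierstrassCurve.Affine.Point.map ι.toRatAlgHom) P =
        Literature.NumberTheory.EllipticCurves.ModularForms.heegnerPointComplex Dt H →
      ¬ IsOfFinAddOrder P → Odd (NumberField.discr K) →
      ∀ (s' : ℕ), s' ≤ padicValNat 3 W.tamagawaProduct + padicValNat 3 Dt.c.natAbs →
      ∀ (n : ℕ) (d : Literature.NumberTheory.EllipticCurves.KolyvaginHeegnerData Dt H.β ι n), Squarefree n →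
      (∀ ℓ ∈ n.primeFactors, Literature.NumberTheory.EllipticCurves.Zhang2014.IsKolyvaginPrime N W K 3 ℓ ∧
        s' ≤ Literature.NumberTheory.EllipticCurves.Zhang2014.kolyvaginIndex W 3 ℓ) →
      Summit.BirchSwinnertonDyer.Rank1Residual.X11b.Three.Koly.PDiv d 3 s')
    (hL0 : Gss2LowerAtThreeRankZero)
    (W : WeierstrassCurve ℚ) [W.IsElliptic] [W.IsGloballyMinimal] [NeZero (W.conductorNorm ℤ)]
    (hCM : ¬ W.HasCM) (hadd : Addv W 3) (hsub : SubGss W 3) (hr : W.analyticRank = 1)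
    (Dt : ModularParametrizationData W (W.conductorNorm ℤ))
    (hopt : ∀ z ∈ Dt.L.lattice, ∃ w ∈ periodLattice Dt.f, z = Dt.c * w) :
    MissingUpperBoundAt W 3 := by
  by_cases hrow : ((∃ (q : ℕ) (_ : Fact q.Prime), q ∣ W.conductorNorm ℤ ∧ ¬ q ^ 2 ∣ W.conductorNorm ℤ ∧
          padicValNat 3 W.tamagawaProduct ≤ padicValNat 3 ((W.baseChange ℚ_[q]).localTamagawaNumber ℤ_[q])) ∧
        (∀ (q' : ℕ) [Fact q'.Prime], q' ∣ W.conductorNorm ℤ →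
          3 ∣ (W.baseChange ℚ_[q']).localTamagawaNumber ℤ_[q'] → ¬ q' ^ 2 ∣ W.conductorNorm ℤ))
  · obtain ⟨⟨q, _, hqN, hq2, hmono⟩, htam⟩ := hrow
    exact leafRankOneUpper_three_monoCarrier_of_divisibilityReading_of_lowerRankZero hGZ hKo hGZK hmod hGZ73 hMN hnf
      hFH hD hL0 W hCM hadd hsub hr q hqN hq2 hmono htam Dt
      (not_three_dvd_c_of_latticeOptimal_of_subGss hM hAU hC2 hnf W Dt hopt hadd hsub)
  · exact leafRankOneUpper_three_of_sigmaAtDatum_of_lowerRankZero hGZ hKo hGZK hmod hGZ73 hMN hnf hFH hL0 W hCM hadd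
      hsub hr Dt (fun K _ _ H ι P hK hHN hLt hP hnt hodd s' hs' n d hn hℓ ↦
        hSig W (W.conductorNorm ℤ) K Dt H ι P hCM hadd hsub hr rfl hopt hrow hK hHN hLt hP hnt hodd s' hs' n d hn hℓ)

end OptimalMember

end Summit.BirchSwinnertonDyer.BirchSwinnertonDyer.Theorems.RamifiedPairUpperBound

end
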